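/-
Origin: expansion seat `planner-pub-hodgecm-mc-sanity-1-g9-0`, handover #1 2026-08-19T16:07Z md5 2dcbfe90551d (REPLACE installed 367ad4d7a124, 361 → 391 l.; (Θ-sat) MECHANICAL RE-STAGE = three hunks in the degenerate constructors: `degThetaSpaceInput` + `KΓ := fun _ => ⊥`; NEW `degKTypeSituation_isStrict`; `degSupplySituationAt` + `sat := KTypeSituation.isSaturated_bot _`, `strict := …`; every statement else byte-identical; author overlay build over theta-3-g8 draft `ThetaSpaceSat` 8d2d12959517 + `ThetaClassInputInstance` 159941f6a585: rc 0, 0 warnings, 0 proof-hole, `#print axioms` 30/30 ⊆ trio) (`HOME/mc/pub-hodgecm-mc-sanity-1-g8/next37/HodgeCM/Model/Sanity/ThetaSpaceInputDegenerate.lean`, md5 2dcbfe90, 391 lines);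
landed by the gen-13 packager (p-g13) in gate run 37 REPLACES the earlier landed copy of `HodgeCM/Model/Sanity/ThetaSpaceInputDegenerate.lean` (verbatim).
-/
/-
Origin: SANITY lane `planner-pub-hodgecm-mc-sanity-1-g8-0` (unit pub-hodgecm-mc-sanity-1-g8, gen 8 of mc-sanity-1),
2026-08-19 — (Θ-sat) MECHANICAL RE-STAGE of the installed RUN-35 leaf (PKG md5 367ad4d7a124, 361 l.) over
mc-theta-3's RUN-37 packet (`Model/ThetaSpaceSat` NEW + `Model/ThetaClassInputInstance` (Θ-sat): `ThetaSpaceInput`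
gains the field `KΓ : Level V → Subgroup GU`, `Θ k Γ := thetaSpaceSatOf … (X.KΓ Γ) …`, `SupplySituationAt` gains the
LAST fields `sat : S.IsSaturated (X.KΓ Γ₀)` and `strict : S.IsStrict`).  Delta = exactly three hunks, all in the
degenerate constructors: `degThetaSpaceInput` gets `KΓ := fun _ => ⊥`; the new lemma `degKTypeSituation_isStrict`
(the one-point situation is strict because `s(κ u, 1) = s 1 = 1` acts trivially, `ThetaKernelDatum.act_one`);
`degSupplySituationAt` gets `sat := KTypeSituation.isSaturated_bot _` and `strict := degKTypeSituation_isStrict …`.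
Every statement and every other byte is unchanged; verdicts unchanged (the pair `(X, A)` stays JOINTLY CHEAP under
(Θ-sat): saturation at `KΓ := ⊥` and strictness of the trivial action are free).  Install AFTER theta-3's
`Model/ThetaSpaceSat` + `Model/ThetaClassInputInstance` (Θ-sat) bytes; rides RUN 37 with that packet, never
stand-alone.  KERNEL: 0 records, 0 hypotheses minted, no global instances; `#print axioms` ⊆ {propext,
Classical.choice, Quot.sound}.
-/
/-
Origin: expansion seat `planner-pub-hodgecm-mc-sanity-1-g3-0`, handover #5 2026-08-19T00:48Z md5 174a6115182b58158425120de70894e5 (NEW, 357 l., 26 decls in namespace HodgeCM.Model.Sanity; imports theta-3-g3's `HodgeCM.Model.ThetaClassInputInstance` (t33-mctheta3g3 #3, 0929594f0aee; itself after #1 SupplyClassLevel 2497dc06b48e, #2 ThetaSpace 514e5f1429ce, period-2-g4 ThetaSideInstance v2 cb2e6dd72a1f) + installed r32 `HodgeCM.Model.Sanity.SupplyPairSanity` + my #1 `Ho (`HOME/mc/pub-hodgecm-mc-sanity-1-g3/lean/ThetaSpaceInputDegenerate.lean`, md5 174a6115, 357 lines);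
landed by the gen-9 packager (p-g9) in gate run 33 as `HodgeCM/Model/Sanity/ThetaSpaceInputDegenerate.lean` (verbatim).
-/
/-
Origin: SANITY lane `planner-pub-hodgecm-mc-sanity-1-g3-0` (unit pub-hodgecm-mc-sanity-1-g3, gen 3 of mc-sanity-1,
node SAN-8), 2026-08-19.  NEW additive leaf under `HodgeCM/Model/Sanity/`; imports mc-theta-3-g3's RUN-33 leaf
`HodgeCM.Model.ThetaClassInputInstance` (md5 0929594f0aee, kit `mc/pub-hodgecm-mc-theta-3-g3/t33-mctheta3g3.txt` #3;
itself after #1 `SupplyClassLevel` 2497dc06b48e, #2 `ThetaSpace` 514e5f1429ce and period-2-g4's `ThetaSideInstance` v2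
cb2e6dd72a1f), the installed r32 sanity leaf `HodgeCM.Model.Sanity.SupplyPairSanity` (gen 2) and SAN-5a
`HodgeCM.Model.Sanity.ThetaClassesDegenerate`; nothing imports it.  Install AFTER all of these.  KERNEL: 0 records,
0 hypotheses minted, no global instances.  Expected `#print axioms`: ⊆ {propext, Classical.choice, Quot.sound}.
-/
import Summits.HodgeConjecture.HodgeCM.Model.ThetaClassInputInstance
import Summits.HodgeConjecture.HodgeCM.Model.Sanity.SupplyPairSanity
import Summits.HodgeConjecture.HodgeCM.Model.Sanity.ThetaClassesDegenerate

/-!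
# SAN-8: the R7 input `X : ThetaSpaceInput` and the supply family `A : SupplySituationAt` have cheap joint inhabitants

mc-theta-3-g3's R7 SUBSTITUTION OFFER (2026-08-19T00:35:50Z) replaces E's data binder `I : ThetaClassInput` by
`I := Model.thetaClassInputOf U X` for a smaller DATA binder `X V c : Model.ThetaSpaceInput U V c`, and discharges
E's `classPacks` by `Model.classPacksOf_thetaModelOf … X … A` from a family
`A : ∀ V c, GoodCtx → finrank = 6 → ∀ k ∈ {0,1}, ∀ N > 0, SupplySituationAt (X V c) k N`.
The offer's note to this lane reads «degenerate-model witnesses are cheap for neither (both contain `WeilPairData`)».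

This file PROFILES both binder types over EVERY universe `U` and context `(V, c)` (rule SAN-6: an instance term or
a degenerate-model witness that the binder's TYPE is inhabited in SOME model):

* § 1 `functionalClassMapDatum ι hΔ hη Λ` — over the one-point archimedean group `G₁ = K₁ = PUnit` with weight
  module `ℂ`, ANY linear functional `Λ` on the coefficient space `H` is a classical class-map datum: `H10 := ⊤`,
  `pull c := Λ c • 1`, `Hol := range pull` (descent by construction).  Through it every class killed by `Λ` is a
  theta class of EVERY space of forms, witnessed by the zero form (`mem_thetaClasses_functional_of_apply_eq_zero`);
  for `Λ = 0` all classes are (`thetaClasses_functional_zero`); for `Λ ≠ 0`, `Hol = ⊤`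
  (`functionalClassMapDatum_Hol_eq_top`).
* § 2 `degThetaSpaceInput U Φ∞ x₀ hx₀ V c Λ : ThetaSpaceInput U V c` — `G₁ = K₁ := PUnit`, `W := ℂ`, `τ₁ := 1`,
  `Δ := ⊤`, `D Γ := functionalClassMapDatum … (Λ Γ)`, carriers `K = L` (any number field), `G_U := Unit`,
  saturation index `KΓ := ⊥` ((Θ-sat)), and ALL
  FOUR pair data `P k :=` gen-2's `SupplyResidual.trivialPairData K K J Unit Φ∞ x₀ hx₀` (trivial Weil action,
  `Γ_U := ⊤`, weight `1`; its (W-wt)/(W-maj⁺)/(W-rat⁺) fields are one-liners, `Model/Sanity/SupplyPairSanity`).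
  So `ThetaSpaceInput U V c` IS cheaply inhabited, `WeilPairData` notwithstanding.
* § 3 the END STATE's `Θ_k(Γ) = thetaOf U (thetaClassInputOf U X_deg) V c k Γ` then CONTAINS THE HYPERPLANE
  `{h | Λ V Γ h = 0}` of `H = U.CohC (U.pms V Γ) 1` (`ker_subset_thetaOf_deg`) and is ALL of `H` wherever
  `Λ V Γ = 0` (`thetaOf_deg_eq_univ`) — no theta form is involved (the witness is `F := 0`).
* § 4 `degSupplySituationAt … k N Γ₀ (hΛ : Λ Γ₀ ≠ 0) : SupplySituationAt X_deg k N` for EVERY `k` and `N`: the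
  `K`-type situation is `Kc := PUnit`, `E := 𝒮` itself with the trivial action, `ι ℓ := ℓ 1 • φ_N`, test families
  `𝓙 := univ` (the identity family is theta-equivariant because `G_U` is a point), `fam` by `φ_N = 1 • φ_N`,
  `hol` because `Hol = ⊤` at a level where `Λ ≠ 0`, `sat` at `KΓ = ⊥` for free (`isSaturated_bot`) and `strict`
  because `s(κ u, 1) = 1` acts trivially (`degKTypeSituation_isStrict`).  Hence (§ 5) R7's family `A` is inhabited as soon as ONE level
  `Γ₀` per surface carries a nonzero functional on `H¹` (`degSupplyFamily`), and through mc-theta-3-g3's own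
  producers `classPacksOf` / `open_supply_of_supplySituations` every theta model `T` with
  `thetaClasses id (X_deg.D Γ) (X_deg.Θ k Γ) ⊆ T.Theta V c k Γ` — definitionally the END STATE model built on
  `thetaOf _ (thetaClassInputOf _ X_deg)` — gets `classPacks` and PerL's `(Open_supply)` with NO analytic input
  (`classPacks_deg`, `open_supply_deg`).

VERDICT (for the carvers' binder-type column; nothing here is an objection to theta-3's files, which are honestly
typed): under R7 the pair `(X, A)` is JOINTLY CHEAP — the discharge «`classPacks` K by `classPacksOf_thetaModelOf`»
is a discharge RELATIVE TO THE PIN of `X`.  The content of (Open_supply) then sits (i) in the PIN `X := (B)`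
(`G₁ := U21`, `τ₁ :=` the cotangent cocycle, `D Γ := Model.classMapDatumOf …` with `pull` injective — K by
mc-autform-2-g4 (C1)/(C2) — and HONEST pair data `P k` = the Weil representation of `U(V) × U(W_k)`, not
`trivialPairData`), which must be a `def` of record before `X` leaves the binder list, and (ii) in `hLiu` /
`thetaSat` / `hBetti`, which are FALSE at `X_deg` (there `Θ_k(Γ) ⊇ ker Λ` is a hyperplane or all of `H¹`, never
inside `H^{1,0}` once `H¹ ≠ 0`) — so E's theorem instantiated at `X_deg` is vacuous, not wrong.  Until (i), the
E-LEDGER must carry `X` as an UNPINNED DATA binder of the same standing as `wm`.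
-/

set_option autoImplicit false

noncomputable section

open Set Function
open MeasureTheory NumberField NumberField.mixedEmbedding
open Literature.NumberTheory.Automorphic Literature.NumberTheory.Weil1964
open Literature.NumberTheory.Automorphic.WeightForms (ClassMapDatum thetaClasses restrictHom IsLevelCorrected
  IsWeightMatched)
open Literature.AlgebraicGeometry.HodgeTheory
open Literature.NumberTheory.Automorphic.PicardCM
open HodgeCM.PerL34.SupplyAdelic HodgeCM.Model.SupplyInstance
open HodgeCM.Model.SupplyResidual HodgeCM.Model.ThetaSpace
open scoped SchwartzMap Classical

namespace HodgeCM
namespace Model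
namespace Sanity

/-! ## § 1. The functional class-map datum over the one-point group -/

section Functional

variable {GU Kc : Type*} [Group GU] [Group Kc] {ΓU : Subgroup GU} {κ : Kc →* GU}
  {τ : Representation ℂ Kc ℂ} (ι : PUnit.{1} →* GU) {η₁ : PUnit.{1} →* Kc}

/-- The constant function `1` on the one-point group: a form of full level and trivial weight. -/
def oneForm : weightForms (⊤ : Subgroup PUnit.{1}) (MonoidHom.id PUnit.{1}) (1 : Representation ℂ PUnit.{1} ℂ) :=
  ⟨fun _ => 1, fun _ _ _ => rfl, fun _ _ => rfl⟩

/-- (Ported verbatim from the HodgeCMPerL package; no docstring in the source.) -/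
@[simp] theorem oneForm_apply (x : PUnit.{1}) : (oneForm : PUnit.{1} → ℂ) x = 1 := rfl

/-- Every form on the one-point group (full level, trivial weight) is a multiple of `oneForm`. -/
theorem eq_smul_oneForm
    (f : weightForms (⊤ : Subgroup PUnit.{1}) (MonoidHom.id PUnit.{1}) (1 : Representation ℂ PUnit.{1} ℂ)) :
    f = (f : PUnit.{1} → ℂ) PUnit.unit • oneForm :=
  Subtype.ext <| funext fun x => by
    rw [Submodule.coe_smul, Pi.smul_apply, oneForm_apply, smul_eq_mul, mul_one]

variable {H : Type*} [AddCommGroup H] [Module ℂ H]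

/-- **The functional datum** of a linear functional `Λ` on the coefficient space: `H10 := ⊤`, `pull c := Λ c • 1`,
`Hol := range pull` — descent holds by construction.  It inhabits `ClassMapDatum ι hΔ hη H` over every restriction
situation whose archimedean group is a point with trivial weight on `ℂ`. -/
def functionalClassMapDatum (hΔ : IsLevelCorrected ΓU κ τ ι ⊤)
    (hη : IsWeightMatched κ τ ι (MonoidHom.id PUnit.{1}) (1 : Representation ℂ PUnit.{1} ℂ) η₁)
    (Λ : Module.Dual ℂ H) : ClassMapDatum ι hΔ hη H where
  H10 := ⊤
  pull := (Λ.comp (⊤ : Submodule ℂ H).subtype).smulRight oneForm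
  Hol := LinearMap.range ((Λ.comp (⊤ : Submodule ℂ H).subtype).smulRight oneForm)
  descends _ hf := LinearMap.mem_range.1 hf

variable {ι} {hΔ : IsLevelCorrected ΓU κ τ ι ⊤}
  {hη : IsWeightMatched κ τ ι (MonoidHom.id PUnit.{1}) (1 : Representation ℂ PUnit.{1} ℂ) η₁} (Λ : Module.Dual ℂ H)

/-- (Ported verbatim from the HodgeCMPerL package; no docstring in the source.) -/
@[simp] theorem functionalClassMapDatum_H10 : (functionalClassMapDatum ι hΔ hη Λ).H10 = ⊤ := rfl

/-- (Ported verbatim from the HodgeCMPerL package; no docstring in the source.) -/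
theorem functionalClassMapDatum_pull_apply (c : (functionalClassMapDatum ι hΔ hη Λ).H10) :
    (functionalClassMapDatum ι hΔ hη Λ).pull c = Λ c • oneForm := rfl

/-- (Ported verbatim from the HodgeCMPerL package; no docstring in the source.) -/
theorem functionalClassMapDatum_Hol :
    (functionalClassMapDatum ι hΔ hη Λ).Hol = LinearMap.range (functionalClassMapDatum ι hΔ hη Λ).pull := rfl

/-- For a NONZERO functional every form is a pullback: `Hol = ⊤`. -/
theorem functionalClassMapDatum_Hol_eq_top (hΛ : Λ ≠ 0) : (functionalClassMapDatum ι hΔ hη Λ).Hol = ⊤ := by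
  obtain ⟨h, hh⟩ := DFunLike.ne_iff.1 hΛ
  rw [LinearMap.zero_apply] at hh
  refine eq_top_iff.2 fun f _ => ⟨⟨((f : PUnit.{1} → ℂ) PUnit.unit * (Λ h)⁻¹) • h, Submodule.mem_top⟩, ?_⟩
  show Λ (((f : PUnit.{1} → ℂ) PUnit.unit * (Λ h)⁻¹) • h) • oneForm = f
  rw [map_smul, smul_eq_mul, mul_assoc, inv_mul_cancel₀ hh, mul_one, ← eq_smul_oneForm]

/-- (Ported verbatim from the HodgeCMPerL package; no docstring in the source.) -/
theorem mem_functionalClassMapDatum_Hol (hΛ : Λ ≠ 0)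
    (f : weightForms (⊤ : Subgroup PUnit.{1}) (MonoidHom.id PUnit.{1}) (1 : Representation ℂ PUnit.{1} ℂ)) :
    f ∈ (functionalClassMapDatum ι hΔ hη Λ).Hol := by
  rw [functionalClassMapDatum_Hol_eq_top Λ hΛ]; exact Submodule.mem_top

/-- **Through the functional datum every class killed by `Λ` is a theta class of EVERY space of forms** — the
witnessing form is `F := 0`. -/
theorem mem_thetaClasses_functional_of_apply_eq_zero (Θ : Submodule ℂ (weightForms ΓU κ τ)) {h : H}
    (h0 : Λ h = 0) : h ∈ thetaClasses ι (functionalClassMapDatum ι hΔ hη Λ) Θ :=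
  ⟨⟨h, Submodule.mem_top⟩, rfl, 0, Θ.zero_mem, by rw [map_zero]; exact Submodule.zero_mem _, by
    rw [map_zero, functionalClassMapDatum_pull_apply]
    show Λ h • oneForm = 0
    rw [h0, zero_smul]⟩

/-- In particular through the ZERO functional every class is a theta class of every space. -/
theorem thetaClasses_functional_zero (Θ : Submodule ℂ (weightForms ΓU κ τ)) :
    thetaClasses ι (functionalClassMapDatum ι hΔ hη (0 : Module.Dual ℂ H)) Θ = univ :=
  eq_univ_of_forall fun h => mem_thetaClasses_functional_of_apply_eq_zero _ Θ (LinearMap.zero_apply h)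

end Functional

/-! ## § 2. A degenerate `ThetaSpaceInput` over every universe and context -/

section Input

variable (U : Universe) {K : Type} [Field K] [NumberField K] {J : Type} [Fintype J]
  (Φinf : 𝓢((J → mixedSpace K), ℂ)) (x₀ : J → K) (hx₀ : Φinf (archEmb K J x₀) ≠ 0)
variable {Lc : CMField} {ι₁ : Lc →+* ℂ} (V : HermSpace3 Lc ι₁) (c : SeesawCtx Lc)
  (Λ : ∀ Γ : Level V, Module.Dual ℂ (U.CohC (U.pms Lc ι₁ V Γ) 1))

/-- **The degenerate theta-space input**: one-point archimedean group, weight module `ℂ` with trivial weight, full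
arithmetic group, the functional datum of `Λ Γ` at each level, carriers `K = L`, `G_U := Unit`, and gen-2's trivial
pair datum at all four type indices. -/
def degThetaSpaceInput : ThetaSpaceInput U V c where
  G₁ := PUnit.{1}
  K₁ := PUnit.{1}
  κ₁ := MonoidHom.id PUnit.{1}
  W := ℂ
  τ₁ := 1
  Δ := fun _ => ⊤
  D := fun Γ => functionalClassMapDatum (MonoidHom.id PUnit.{1})
    (isLevelCorrected_id ⊤ (MonoidHom.id PUnit.{1}) 1) (isWeightMatched_id (MonoidHom.id PUnit.{1}) 1) (Λ Γ)
  K := K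
  L := K
  J := J
  GU := Unit
  P := fun _ => trivialPairData K K J Unit Φinf x₀ hx₀
  instCompact := fun _ => compactSpace_quotient_top
  ιinf := fun _ => MonoidHom.id PUnit.{1}
  KΓ := fun _ => ⊥

/-- (Ported verbatim from the HodgeCMPerL package; no docstring in the source.) -/
@[simp] theorem degThetaSpaceInput_P (k : Fin 4) :
    (degThetaSpaceInput U Φinf x₀ hx₀ V c Λ).P k = trivialPairData K K J Unit Φinf x₀ hx₀ := rfl

/-- (Ported verbatim from the HodgeCMPerL package; no docstring in the source.) -/
@[simp] theorem degThetaSpaceInput_D (Γ : Level V) :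
    (degThetaSpaceInput U Φinf x₀ hx₀ V c Λ).D Γ = functionalClassMapDatum (MonoidHom.id PUnit.{1})
      (isLevelCorrected_id ⊤ (MonoidHom.id PUnit.{1}) 1) (isWeightMatched_id (MonoidHom.id PUnit.{1}) 1) (Λ Γ) :=
  rfl

end Input

/-! ## § 3. The verdicts on the END STATE's `Θ_k(Γ)` through the degenerate input -/

section Verdicts

variable (U : Universe) {K : Type} [Field K] [NumberField K] {J : Type} [Fintype J]
  (Φinf : 𝓢((J → mixedSpace K), ℂ)) (x₀ : J → K) (hx₀ : Φinf (archEmb K J x₀) ≠ 0)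
  (Λ : ∀ {Lc : CMField} {ι₁ : Lc →+* ℂ} (V : HermSpace3 Lc ι₁) (Γ : Level V),
    Module.Dual ℂ (U.CohC (U.pms Lc ι₁ V Γ) 1))
variable {Lc : CMField} {ι₁ : Lc →+* ℂ} (V : HermSpace3 Lc ι₁) (c : SeesawCtx Lc) (k : Fin 4) (Γ : Level V)

/-- **Every class killed by `Λ V Γ` is a theta class of the END STATE at `(V, c, k, Γ)`** through the degenerate
input — a hyperplane of `H¹` (or all of it), with the zero form as witness. -/
theorem ker_subset_thetaOf_deg :
    {h | Λ V Γ h = 0} ⊆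
      thetaOf U (thetaClassInputOf U fun V c => degThetaSpaceInput U Φinf x₀ hx₀ V c (Λ V)) V c k Γ := by
  rw [thetaOf_thetaClassInputOf]
  exact fun h h0 => mem_thetaClasses_functional_of_apply_eq_zero _ _ h0

/-- **Where the functional vanishes, every class is a theta class of the END STATE.** -/
theorem thetaOf_deg_eq_univ (h0 : Λ V Γ = 0) :
    thetaOf U (thetaClassInputOf U fun V c => degThetaSpaceInput U Φinf x₀ hx₀ V c (Λ V)) V c k Γ = univ :=
  eq_univ_of_forall fun h => ker_subset_thetaOf_deg U Φinf x₀ hx₀ Λ V c k Γ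
    (show Λ V Γ h = 0 by rw [h0, LinearMap.zero_apply])

/-- In particular through the ZERO family of functionals `Θ_k(Γ) = H¹` identically. -/
theorem thetaOf_deg_zero :
    thetaOf U (thetaClassInputOf U fun V c => degThetaSpaceInput U Φinf x₀ hx₀ V c fun _ => 0) V c k Γ = univ :=
  thetaOf_deg_eq_univ U Φinf x₀ hx₀ (fun _ _ => 0) V c k Γ rfl

end Verdicts

/-! ## § 4. A supply situation at every `φ_N` from one nonzero functional -/

section Supply

variable {K : Type} [Field K] [NumberField K] {J : Type} [Fintype J]
  (Φinf : 𝓢((J → mixedSpace K), ℂ)) (x₀ : J → K) (hx₀ : Φinf (archEmb K J x₀) ≠ 0)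

/-- The identity test family of the trivial pair datum is theta-equivariant for the one-point `K`-type (the adelic
group is a point, so `s(κ k, 1) = 1`). -/
theorem isThetaEquivariant_id_trivialPairData :
    (trivialPairData K K J Unit Φinf x₀ hx₀).kernelDatum.IsThetaEquivariant (MonoidHom.id PUnit.{1})
      (1 : Representation ℂ PUnit.{1} (trivialPairData K K J Unit Φinf x₀ hx₀).weilDatum.ThetaTop)
      LinearMap.id := by
  intro k e S
  have hs : (trivialPairData K K J Unit Φinf x₀ hx₀).kernelDatum.s ((MonoidHom.id PUnit.{1}) k, 1) = 1 :=
    map_one _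
  rw [hs, mul_one]
  rfl

/-- **The one-point `K`-type situation of `φ_N`** over the trivial pair datum: `Kc := PUnit`, `E := 𝒮` with the
trivial action, `ι ℓ := ℓ 1 • φ_N`, all theta-equivariant families as test families. -/
def degKTypeSituation (N : ℕ) :
    KTypeSituation (trivialPairData K K J Unit Φinf x₀ hx₀) (MonoidHom.id PUnit.{1}) (⊤ : Subgroup PUnit.{1})
      (MonoidHom.id PUnit.{1}) (1 : Representation ℂ PUnit.{1} ℂ) where
  Kc := PUnit.{1}
  κ := MonoidHom.id PUnit.{1}
  E := (trivialPairData K K J Unit Φinf x₀ hx₀).weilDatum.ThetaTop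
  σ := 1
  τ := 1
  ι :=
    { toFun := fun ℓ => ℓ 1 • (trivialPairData K K J Unit Φinf x₀ hx₀).testFunT N
      map_add' := fun a b => by rw [LinearMap.add_apply, add_smul]
      map_smul' := fun a ℓ => by rw [LinearMap.smul_apply, RingHom.id_apply, smul_eq_mul, mul_smul] }
  hι x ℓ := by
    have h1 : (1 : Representation ℂ PUnit.{1} ℂ).dual x ℓ = ℓ := by
      rw [Representation.dual_apply, MonoidHom.one_apply, Module.Dual.transpose_apply]
      exact LinearMap.comp_id ℓ
    rw [h1, MonoidHom.one_apply, Module.End.one_apply]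
  η₁ := MonoidHom.id PUnit.{1}
  hΔ := punit_isLevelCorrected ℂ ⊤
  hη := punit_isWeightMatched ℂ
  𝓙 := univ

/-- (Ported verbatim from the HodgeCMPerL package; no docstring in the source.) -/
theorem degKTypeSituation_ι_apply (N : ℕ) (ℓ : Module.Dual ℂ ℂ) :
    (degKTypeSituation Φinf x₀ hx₀ N).ι ℓ = ℓ 1 • (trivialPairData K K J Unit Φinf x₀ hx₀).testFunT N := rfl

/-- **The one-point situation is STRICT** ((SS-K) exit (X1), `ThetaSpace.KTypeSituation.IsStrict`): with the trivial
action on `E := 𝒮` and `s(κ u, 1) = s 1 = 1` acting trivially (`ThetaKernelDatum.act_one`), every family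
intertwines ON THE NOSE. -/
theorem degKTypeSituation_isStrict (N : ℕ) : (degKTypeSituation Φinf x₀ hx₀ N).IsStrict := by
  intro j _ u e
  have hs : (trivialPairData K K J Unit Φinf x₀ hx₀).kernelDatum.s ((degKTypeSituation Φinf x₀ hx₀ N).κ u, 1) = 1 :=
    map_one _
  rw [hs, ThetaKernelDatum.act_one]
  rfl

variable (U : Universe) {Lc : CMField} {ι₁ : Lc →+* ℂ} (V : HermSpace3 Lc ι₁) (c : SeesawCtx Lc)
  (Λ : ∀ Γ : Level V, Module.Dual ℂ (U.CohC (U.pms Lc ι₁ V Γ) 1))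

/-- **A supply situation at `φ_N` for the degenerate input**, for EVERY type index `k` and EVERY `N`, at any level
`Γ₀` whose functional is nonzero: `fam` is `φ_N = 1 • φ_N` through the identity family, `hol` is `Hol = ⊤`. -/
def degSupplySituationAt (k : Fin 4) (N : ℕ) (Γ₀ : Level V) (hΛ : Λ Γ₀ ≠ 0) :
    SupplySituationAt (degThetaSpaceInput U Φinf x₀ hx₀ V c Λ) k N where
  Γ₀ := Γ₀
  S := degKTypeSituation Φinf x₀ hx₀ N
  fam := ⟨⟨LinearMap.id, isThetaEquivariant_id_trivialPairData Φinf x₀ hx₀⟩, mem_univ _, LinearMap.id, by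
    show (1 : ℂ) • (trivialPairData K K J Unit Φinf x₀ hx₀).testFunT N = _
    exact one_smul ℂ _⟩
  hol _ _ f _ := mem_functionalClassMapDatum_Hol (Λ Γ₀) hΛ _
  sat := KTypeSituation.isSaturated_bot _
  strict := degKTypeSituation_isStrict Φinf x₀ hx₀ N

/-- Hence the binder type `SupplySituationAt (X V c) k N` is inhabited, for every `k` and `N`, as soon as one level
carries a nonzero functional on `H¹`. -/
theorem nonempty_supplySituationAt_deg (hΛ : ∃ Γ₀ : Level V, Λ Γ₀ ≠ 0) (k : Fin 4) (N : ℕ) :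
    Nonempty (SupplySituationAt (degThetaSpaceInput U Φinf x₀ hx₀ V c Λ) k N) :=
  let ⟨Γ₀, h⟩ := hΛ
  ⟨degSupplySituationAt Φinf x₀ hx₀ U V c Λ k N Γ₀ h⟩

end Supply

/-! ## § 5. R7's family `A` and `classPacks` / (Open_supply) through mc-theta-3-g3's producers, for free -/

section Producer

variable (U : Universe) {K : Type} [Field K] [NumberField K] {J : Type} [Fintype J]
  (Φinf : 𝓢((J → mixedSpace K), ℂ)) (x₀ : J → K) (hx₀ : Φinf (archEmb K J x₀) ≠ 0)
  (Λ : ∀ {Lc : CMField} {ι₁ : Lc →+* ℂ} (V : HermSpace3 Lc ι₁) (Γ : Level V),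
    Module.Dual ℂ (U.CohC (U.pms Lc ι₁ V Γ) 1))

/-- **R7's family `A`, in its literal shape, from one nonzero functional per surface** (the `GoodCtx`, degree and
positivity hypotheses are not used). -/
def degSupplyFamily (hΛ : ∀ {Lc : CMField} {ι₁ : Lc →+* ℂ} (V : HermSpace3 Lc ι₁), ∃ Γ₀ : Level V, Λ V Γ₀ ≠ 0)
    (T : U.ThetaModel) :
    ∀ {Lc : CMField} {ι₁ : Lc →+* ℂ} (V : HermSpace3 Lc ι₁) (c : SeesawCtx Lc), T.GoodCtx ι₁ c →
      Module.finrank ℚ c.K = 6 → ∀ k : Fin 4, k = 0 ∨ k = 1 → ∀ N : ℕ, 0 < N →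
        SupplySituationAt (degThetaSpaceInput U Φinf x₀ hx₀ V c (Λ V)) k N :=
  fun V c _ _ k _ N _ =>
    degSupplySituationAt Φinf x₀ hx₀ U V c (Λ V) k N (Classical.choose (hΛ V)) (Classical.choose_spec (hΛ V))

/-- **`classPacks` for free**: for ANY theta model `T` whose `Θ_k(Γ)` contains the theta classes of the degenerate
input — definitionally the END STATE model `thetaModelOf … (thetaOf _ (thetaClassInputOf _ X_deg)) d12 d34`
(`Model.classPacksOf_thetaModelOf`, `hT := fun … hx => hx`) — E's binder `classPacks` in the `ClassSupplyPackN`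
shape holds at every good sextic context, through mc-theta-3-g3's producer `classPacksOf`, with NO analytic input. -/
theorem classPacks_deg (hΛ : ∀ {Lc : CMField} {ι₁ : Lc →+* ℂ} (V : HermSpace3 Lc ι₁), ∃ Γ₀ : Level V, Λ V Γ₀ ≠ 0)
    (T : U.ThetaModel)
    (hT : ∀ {Lc : CMField} {ι₁ : Lc →+* ℂ} (V : HermSpace3 Lc ι₁) (c : SeesawCtx Lc) (k : Fin 4) (Γ : Level V),
      thetaClasses (MonoidHom.id (degThetaSpaceInput U Φinf x₀ hx₀ V c (Λ V)).G₁)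
        ((degThetaSpaceInput U Φinf x₀ hx₀ V c (Λ V)).D Γ) ((degThetaSpaceInput U Φinf x₀ hx₀ V c (Λ V)).Θ k Γ) ⊆
        T.Theta V c k Γ)
    {Lc : CMField} {ι₁ : Lc →+* ℂ} (V : HermSpace3 Lc ι₁) (c : SeesawCtx Lc) (hc : T.GoodCtx ι₁ c)
    (h6 : Module.finrank ℚ c.K = 6) :
    Nonempty (ClassSupplyPackN T V c 0) ∧ Nonempty (ClassSupplyPackN T V c 1) :=
  classPacksOf (fun V c => degThetaSpaceInput U Φinf x₀ hx₀ V c (Λ V)) T hT (degSupplyFamily U Φinf x₀ hx₀ Λ hΛ T)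
    V c hc h6

/-- … and PerL's `(Open_supply)` for such a model, through `open_supply_of_supplySituations`. -/
theorem open_supply_deg (hΛ : ∀ {Lc : CMField} {ι₁ : Lc →+* ℂ} (V : HermSpace3 Lc ι₁), ∃ Γ₀ : Level V, Λ V Γ₀ ≠ 0)
    (T : U.ThetaModel)
    (hT : ∀ {Lc : CMField} {ι₁ : Lc →+* ℂ} (V : HermSpace3 Lc ι₁) (c : SeesawCtx Lc) (k : Fin 4) (Γ : Level V),
      thetaClasses (MonoidHom.id (degThetaSpaceInput U Φinf x₀ hx₀ V c (Λ V)).G₁)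
        ((degThetaSpaceInput U Φinf x₀ hx₀ V c (Λ V)).D Γ) ((degThetaSpaceInput U Φinf x₀ hx₀ V c (Λ V)).Θ k Γ) ⊆
        T.Theta V c k Γ)
    (h6 : ∀ {Lc : CMField} {ι₁ : Lc →+* ℂ} (c : SeesawCtx Lc), T.GoodCtx ι₁ c → Module.finrank ℚ c.K = 6) :
    T.Open_supply :=
  open_supply_of_supplySituations (fun V c => degThetaSpaceInput U Φinf x₀ hx₀ V c (Λ V)) T hT
    (degSupplyFamily U Φinf x₀ hx₀ Λ hΛ T) h6

/-- **The hypothesis `hT` of `classPacks_deg` at the theta classes of the degenerate input contains a hyperplane**: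
any model `T` it applies to has `{h | Λ V Γ h = 0} ⊆ T.Theta V c k Γ` — so `hT` is never met by a model whose
`Θ_k(Γ)` lies inside a proper subspace missing `ker (Λ V Γ)` (e.g. inside `H^{1,0} ≠ H¹`). -/
theorem ker_subset_theta_of_hT (T : U.ThetaModel)
    (hT : ∀ {Lc : CMField} {ι₁ : Lc →+* ℂ} (V : HermSpace3 Lc ι₁) (c : SeesawCtx Lc) (k : Fin 4) (Γ : Level V),
      thetaClasses (MonoidHom.id (degThetaSpaceInput U Φinf x₀ hx₀ V c (Λ V)).G₁)
        ((degThetaSpaceInput U Φinf x₀ hx₀ V c (Λ V)).D Γ) ((degThetaSpaceInput U Φinf x₀ hx₀ V c (Λ V)).Θ k Γ) ⊆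
        T.Theta V c k Γ)
    {Lc : CMField} {ι₁ : Lc →+* ℂ} (V : HermSpace3 Lc ι₁) (c : SeesawCtx Lc) (k : Fin 4) (Γ : Level V) :
    {h | Λ V Γ h = 0} ⊆ T.Theta V c k Γ :=
  fun _ h0 => hT V c k Γ (mem_thetaClasses_functional_of_apply_eq_zero _ _ h0)

end Producer

end Sanity
end Model
end HodgeCM

end
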